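import Mathlib
import HarnessLib
import HarnessLib.Audit
import Summits.SmoothPoincare4.Statement
import Literature.Topology.FourManifolds.HomotopyBallSlice
import Literature.Topology.FourManifolds.RLinkSphere
import Literature.Topology.FourManifolds.HomotopySpheres
import Literature.Topology.FourManifolds.Morse
import Literature.Topology.FourManifolds.HomotopyS4CompactProofs
import Literature.Topology.FourManifolds.HomotopyS4OrientableProofs
import HarnessLib.Audit.Status.Attr

/-!
Route: RootDecompQ

# Route RootDecompQ — Root decomposition Q (RibbonDial, lens 4, gen 4) — SPC4 iff no link certifies
a fake ball, no 1-handles, sslice R-link spheres embed, (ribbon | non-ribbon) R-link spheres with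
std punctures are S⁴

X = E_L ∧ G ∧ W ∧ C ∧ R₂ₐ ∧ R₂ᵦ with R₂ᵦ ⟺ Rib ∧ NonRib (root decomposition cell decomp-sp4, lens 4
«minimal counterexample / extremal reduction», gen 4, node RibbonDial —
OR-sibling of the born route RootDecompJ rev 1 carrying the RIBBON DIAL of J's declared residual;
kernel file decomp-sp4-lens-4/gen4/RibbonDial.lean: `closesO6` (= this route's
`closes`), `closesO7` (flattened), `embeddedGscStandard_iff_ribbonSplit : R₂ᵦ ↔ Rib ∧ NonRib`
unconditional, `ssliceRLinkStandard_iff_split3 : C → (R₂ ↔ R₂ₐ ∧ Rib ∧ NonRib)`).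
Top layer = SIX items POOLED VERBATIM from RootDecompJ rev 1 (E_L #26691 attacked there, G #0378, W
#25269 support, C #26693 support, R₂ₐ #27377, R₂ᵦ #27378); the new content is
the layer-2 split of R₂ᵦ along the MORSE DATA OF THE SLICE-DISC SYSTEM: β(L) = least number of
interior local maxima of a disc system for L in B⁴; ribbon ⟺ β = 0.
Rib = `RibbonEmbeddedStandard` (NEW, the node's ATTACKED piece): an R-link sphere with standard
punctures whose attaching link bounds a pairwise-disjoint system of RIBBON discs
(tree predicate `Knot.IsRibbonDisc`) is diffeomorphic to S⁴. NonRib = `NonRibbonEmbeddedStandard`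
(NEW, DECLARED RESIDUAL): the same for links bounding NO ribbon system.
Lean: `Summit.SmoothPoincare4.SmoothPoincare4.Theses.RootDecompQ.HBallSystemsSlice ∧
Summit.SmoothPoincare4.SmoothPoincare4.Theses.RootDecompQ.NoOneHandlesExist ∧
Summit.SmoothPoincare4.SmoothPoincare4.Theses.RootDecompQ.MorseGscIsRLinkSphere ∧
Summit.SmoothPoincare4.SmoothPoincare4.Theses.RootDecompQ.CoreDiscSystem ∧
Summit.SmoothPoincare4.SmoothPoincare4.Theses.RootDecompQ.SSliceSpheresEmbed ∧
Summit.SmoothPoincare4.SmoothPoincare4.Theses.RootDecompQ.EmbeddedGscStandard`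

## Assembly
Pure logic + the two landed facts already used by RootDecompJ.closes (routeO/glue_layered.lean =
kernel `Ribbon.closesO6`): M ≃ₕ S⁴ is compact and orientable, G + W present
M = Σ_L, C gives the core system, E_L makes L strongly slice in S⁴ off a ball, R₂ₐ embeds the
punctures, R₂ᵦ recognises M ≅ S⁴ — all six binders consumed. After birth R₂ᵦ is
SPLIT (EDIT.md step 2) into Rib ∧ NonRib with glue `EmbeddedGscStandardGlue : RibbonEmbeddedStandard
→ NonRibbonEmbeddedStandard → EmbeddedGscStandard` (excluded middle on
«L bounds a ribbon system», routeO/glue2_split.txt); exactness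
`Ribbon.embeddedGscStandard_iff_ribbonSplit` (unconditional) and S ⟹ every item (kernel
`…_of_summit`), so the
node is EXACT mod the supports: `Ribbon.ssliceRLinkStandard_iff_split3 (hC) : R₂ ↔ R₂ₐ ∧ Rib ∧
NonRib`.

Rationale: WHY THIS LINE. RootDecompJ (gen 2–3 of this lens) certified fake balls by LINKS and cut the GSC
recognition problem down to R₂ᵦ «R-link spheres with standard punctures are standard», a
recognition leaf with no mechanism (every decided row is standard outright). The extremal lens now
asks what a MINIMAL counterexample inside R₂ᵦ looks like through the one
datum no other cell quantifies over — the slice-disc SYSTEM Δ its link bounds in B⁴ (it bounds one: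
gen 3, kernel mod C, cores transported along the punctured embedding +
Palais). If Δ can be chosen RIBBON (no interior maxima), the system exterior E_Δ = B⁴ ∖ N(Δ) is a
handlebody with m 1-handles and b = m − n 2-handles and FREE π₁ of rank n
(MagnusKarrassSolitar Cor 5.14.2 [corpus:book:magnusnd-combinatorial-group-theory p.347]); turned
upside down, S⁴ = X_L ∪ E_Δ is the trace X_L plus b 2-handles along the DUAL
BAND LINK C ⊂ ∂X_L = #ⁿS¹×S², m 3-handles and a 4-handle, while Σ_L = X_L ∪ ♮ⁿS¹×B³
(LaudenbachPoenaru1972). So on the ribbon stratum Σ_L ≅ S⁴ becomes a RELATIVE weak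
generalised-Property-R statement for C — b components in #ⁿS¹×S² instead of n components in S³ — and
b is the extremal parameter: b = 0 is the unlink, b = 1 is DECIDED by the
argument of GompfScharlemannThompson2010 Prop 3.2 [corpus:paper:arxiv-1103.1601 p.6] with S¹×S²
replaced by #ⁿS¹×S² (Gabai's sutured-manifold tautness + Property R +
Kneser–Milnor; n = 1 verbatim in print), so a minimal counterexample is a ribbon R-link with b ≥ 2
essential bands, or it is NOT RIBBON AT ALL — the declared residual NonRib,
a population that is printed-open to be non-empty (GST §8 Questions on L_(n,k) [p.18]; every R-link
is homotopy-ribbon, MeierZupan2022 [corpus:paper:arxiv-1904.08527 p.7])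
and whose only candidates have standard spheres (Gompf 1991). The split is an honest dial (kernel
schema `embeddedGscStandard_iff_dial`: for every population predicate P,
R₂ᵦ ⟺ R₂ᵦ|P ∧ R₂ᵦ|¬P, both halves S-implied); its value is DISTRIBUTION: every technique and every
decided row of the GSC axis (Gabai n ≤ 1, GST 3.2/3.3, MSZ 2016 tunnel
number n, MZ22 Thm 1.1, the 41 slide-certified census R-links — slides⁻¹ = bands ⟹ ribbon, census v4
M6′d) lives in Rib, and Rib alone carries the relative-Property-R lever.
Imported areas: ribbon concordance / fusion presentations, sutured-manifold theory (Gabai), Kirby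
calculus of R-links with Hopf pairs (GST §10), LP closing. Differs by
construction from lenses 1 (Schoenflies genus), 2 (Gluck dissolution), 3 (stable mirror), 5
(branched-cover sheets), 6 (chirality / ±ℂℙ²): none quantifies over disc systems.

RANKED CRUXES. #2 HBallSystemsSlice (crux) — E_L = stmt-SmoothPoincare4-26691 POOLED VERBATIM (J's
ATTACKED crux): no LINK certifies a fake 4-ball — a link bounding a pairwise-disjoint system of
smooth slice discs in some smooth M ≃ₕ S⁴ off an embedded open ball bounds one in the round S⁴ off a
ball (≡ is strongly slice in B⁴). [difficulty: open-problem] (why it might fail: the R-link of a GSC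
exotic sphere, or a 2-component link à la GST L_(n,k) in a fake ball, strongly slice there and
obstructed in B⁴ by a link-concordance invariant NOT blind on homotopy balls (none known: s, τ blind
for knots, KM13; for links s-blindness = MMSW Q9.11, open; μ̄ topological).) [arXiv:1103.1601,
FreedmanGompfMorrisonWalker2010, arXiv:2102.04391, KronheimerMrowka2013,
ManolescuMarengonSarkarWillis2023]
#3 EmbeddedGscStandard (crux) — R₂ᵦ = stmt-SmoothPoincare4-27378 POOLED VERBATIM (J's declared
residual, layer-2 child there; TOP-LAYER here so that it can be SPLIT at once by the ribbon dial,
EDIT.md step 2): every R-link sphere Σ_L all of whose punctures are diffeomorphic to open subsets of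
the round S⁴ is diffeomorphic to S⁴. [difficulty: open-problem] (why it might fail: An exotic GSC
homotopy sphere that is also a capped Schoenflies ball (the GNS Q5.6 family, if exotic and GSC)
defeats it; every decided row (n ≤ 1 Gabai; Q_{p,q} ∪ J MZ22 Thm 1.1; Gompf 1991) is standard
outright — no recognition argument has ever USED invertibility, no tool consumes it.)
[stmt-SmoothPoincare4-0377 (NoohGscStandard), stmt-SmoothPoincare4-18065 (InvertibleStandard),
arXiv:1904.08527 Thm 1.1 p.3 (MeierZupan2022), arXiv:2307.06388 Q5.6 p.13, arXiv:1103.1601 §8 p.18,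
Question 9.x (GompfScharlemannThompson2010), FreedmanGompfMorrisonWalker2010 §2]
#4 SSliceSpheresEmbed (crux) — R₂ₐ = stmt-SmoothPoincare4-27377 POOLED VERBATIM: strongly slice
R-links give spheres with standard punctures (for every R-link sphere Σ_L whose link bounds a
disjoint slice-disc system in S⁴ off a ball, every puncture Σ_L ∖ {p} is diffeomorphic to an open
subset of S⁴). [difficulty: open-problem] (why it might fail: Strong sliceness embeds X_L = B⁴ ∪
N(Δ̄) in S⁴ but not the 3-handles: Σ_L° ↪ S⁴ needs the n belt spheres to bound disjoint 3-balls in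
the system exterior E_Δ; an sslice R-link with π₁(E_Δ) not free rel. meridians could carry a
non-invertible Σ_L, and no invariant detects that.) [arXiv:1103.1601 Prop 2.3 p.5, §8 p.18
(GompfScharlemannThompson2010), arXiv:2307.06388 Thm 5.5, Q5.4, Q5.6 p.13, HassKirby2025 §4 Q4.2,
FreedmanGompfMorrisonWalker2010 §2 Fact 2.1, arXiv:1904.08527 Thm 1.1 p.3, p.34 (MeierZupan2022),
doi:10.1016/0040-9383(91)90036-4 (Gompf 1991)]
#5 NoOneHandlesExist (crux) — G = stmt-SmoothPoincare4-0378 POOLED VERBATIM: every homotopy 4-sphere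
admits a handle decomposition without 1-handles (imported residual of the GSC axis, owner
NoOneHandles/#0378). [difficulty: open-problem] (why it might fail: an exotic S⁴ all of whose handle
decompositions need 1-handles; at b₂ = 0 no obstruction to removing 1-handles is known, but none to
their necessity either (Kirby 4.18 open since 1978).) [Kirby1997, arXiv:1103.1601]
#9 MorseGscIsRLinkSphere (support) — W = stmt-SmoothPoincare4-25269 POOLED VERBATIM (support,
theorem on paper: Morse/handle calculus): a homotopy 4-sphere with a self-indexing Morse function
without index-1 critical points is an R-link sphere Σ_L. [difficulty: M] (why it might fail: routine
(Milnor Morse theory + handle cancellation bookkeeping); only the formalisation is long.)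
[arXiv:1103.1601, Kirby1989, Milnor1965]
#9 CoreDiscSystem (support) — C = stmt-SmoothPoincare4-26693 POOLED VERBATIM (support, theorem on
paper = printed strength of GST 2010 Prop 2.3): the attaching R-link of Σ_L bounds the cocore disc
system in Σ_L off a ball. [difficulty: L] (why it might fail: it does not (theorem: GST 2010 Prop
2.3 proof; Kirby1989 I §2); formal risk only — the simultaneous version of the landed one-component
construction.) [arXiv:1103.1601, Kirby1989, Hillman1981]

TWO-LAYER PLAN. Layer 2 (filed right after birth, EDIT.md step 2): R₂ᵦ ⟸ Rib ∧ NonRib (glue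
`EmbeddedGscStandardGlue`, pure logic; exact). Foreseen below Rib (NOT filed — provers attach lemmas
`--supports RibbonEmbeddedStandard`): (a) the dual-link lemma «ribbon system with b bands ⟹ S⁴ = X_L
∪_C b·h² ∪ m·h³ ∪ h⁴ with C ⊂ #ⁿS¹×S²» (handle calculus, GS 6.2); (b) relative
Property R for ONE extra component «a framed knot C ⊂ #ⁿS¹×S² with surgery #ⁿ⁺¹S¹×S² is isotopic to
a 0-framed unknot in a ball» (Gabai [Ga2] + Property R + Kneser–Milnor;
gives the b ≤ 1 rung); (c) LP cancellation «X ♮ (S²×D²) ∪ ♮ⁿ⁺¹S¹×B³ ≅ X ∪ ♮ⁿS¹×B³». Rib|b ≤ 1 =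
(a)+(b)+(c); Rib|b ≥ 2 is the open core (relative weak GPR for a
b-component link in #ⁿS¹×S²).

KILL CRITERIA. Rib refuted by a RIBBON R-link L with standard punctures and Σ_L exotic (refutes S).
NonRib refuted by a non-ribbon strongly slice R-link with exotic invertible Σ_L (refutes S).
E_L refuted by one link strongly slice in a homotopy ball and not in B⁴ (refutes S). The ROUTE is
retired (not S) if the dial is shown idle: a proof that every strongly slice
R-link is ribbon (then NonRib is vacuous and the route EQUALS J rev 1 with R₂ᵦ renamed Rib — fold
back into J), or a proof of Rib that never uses the ribbon hypothesis (then it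
proves R₂ᵦ; credit J).

NOT DECOMPOSED YET. Rib beyond b ≤ 1: the band-number sub-dial b(Δ) = number of saddles of a ribbon
system is the next extremal cut (b ≤ 1 decided on paper) but is NOT typable today — the tree's
`Knot.IsRibbonDisc` records «no interior local maximum», not Morse index counts of the radial
function on the disc; typing it needs a Morse-critical-point API for maps
𝔻² → 𝔼⁴ (definition request D3, deferred). NonRib: IDEA-NEEDED (no ribbon obstruction survives
sliceness for R-links; Alexander/Fox–Milnor/Casson–Gordon blind).

CHEAPEST FALSIFIER. T-RIBBON-R (desk + ≤ 10 core-h SnapPy/regina, census seat): fusion-band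
presentations for (i) the 41 slide-certified census R-links (b = #slides, calibration), (ii) the
attaching
R-links of the Φ12 GNS spheres (census g4 paper lemma: GSC) and of the MP rows 376/383/384/386,
(iii) GST L_(2,2), L_(3,1): report b(L) and the dual link C ⊂ #ⁿS¹×S². Rows
with b ≤ 1 are decided by the node's lemma; a row with b ≥ 2 whose C resists the relative-Property-R
reduction is the near-counterexample Rib must explain; a row with NO
findable ribbon system (T-RIB-NEG, one-sided search à la Dunfield–Gong arXiv:2512.21825) populates
NonRib. Either outcome is informative.

NUMBERS. n = components = 2- /3-handles of Σ_L; m = minima, b = m − n = bands (saddles) of a ribbon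
system; β = least number of maxima over all systems (ribbon ⟺ β = 0). Decided:
n ≤ 1 all b (Gabai 1987); all n, b ≤ 1 (this node, on paper); n = 2 with an unknotted / fibred
non-minimal-genus component (GST 2010); tunnel number n (MSZ 2016); census
≤ 14 crossings 41/41 ribbon with b ≤ #slides. A minimal counterexample inside Rib has n ≥ 2 and b ≥
2.

DEFINITION REQUESTS. D1/D2 of RootDecompJ (IsSliceSystemIn / IsStronglySlice) unchanged, inlined.
NEW, inlined in the two children (birth needs nothing): `IsRibbonSystem (L : Link ι) (g : ι → 𝔼² →
𝔼⁴)
: Prop := (∀ i, (L.component i).IsRibbonDisc (g i)) ∧ Pairwise (Disjoint of the closed-disc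
images)`, `HasRibbonSystem L := ∃ g, IsRibbonSystem L g` (topic
Literature/Topology/FourManifolds next to SliceRibbon.lean; the lens file proves
`hasRibbonSystem_of_isEmpty`, `hasRibbonSystem_of_component_eq_unknot`,
`IsRibbonSystem.toDottedCircleDiagram`). Deferred D3: band number of a ribbon system (Morse index
count), see Not decomposed yet.

Novelty: Searches RUN (2026-08-30): rg over Summits/SmoothPoincare4/SmoothPoincare4/{Theses,Theorems} for
`IsRibbonDisc|IsRibbon |ribbon system|HasRibbon` → ribbon occurs only for 2-KNOTS
(Gluck routes) and for knot discs in route I's D-RIB instrument — no item conditions an R-link /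
attaching-link statement on ribbon-ness; BC4 `exact?` fails 2/2; `ledger
negatives --problem SmoothPoincare4` → 0 statements. Corpus: `lit search --hybrid "ribbon R-link
Property 2R slice ribbon link"` → [corpus:paper:arxiv-1103.1601 p.18–21]
(GST §8 «Slice but not ribbon?», Questions; Prop 9.2; §10 Hopf pairs),
[corpus:paper:arxiv-1904.08527 p.4, p.7, p.34] (MZ22: ribbon ⊂ homotopy-ribbon ⊂ slice, every R-link
homotopy-ribbon, «Stable GPR ⟹ ribbon?»), [corpus:book:magnusnd-combinatorial-group-theory p.347]
(MKS 5.14.2), [corpus:paper:arxiv-2512.21825] (ribbon-disc search);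
galaxy `"ribbon R-link|R-link is ribbon|ribbon 2R-link|R-links are ribbon" --star all` → no hits;
`--star pdf "Generalized Property R|Property 2R|homotopy-ribbon"` → only
[galaxy:pdf:1769936740] (Bar-Natan handouts, irrelevant). Nearest prior art: GST 2010 §8 (asks
whether L_(n,k) is ribbon; does not condition standardness on it), MZ22 §2
(homotopy-ribbon for all R-links), RootDecompJ #27378 (the parent). Delta: conditioning
GSC∧invertible recognition on a RIBBON SYSTEM turns Σ_L ≅ S⁴ into relative weak
Property R for the dual band link in #ⁿS¹×S² with the band number as induction parameter (b ≤ 1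
decided) — claimed grade new-combinati  [refs: paper:arxiv-1103.1601, paper:arxiv-1904.08527, book:magnusnd-combinatorial-group-theory, paper:arxiv-2512.21825]

Barriers (technique_class: disc-systems, R-links, ribbon-systems, relative-Property-R): - technique_class: disc-systems, R-links, ribbon-systems, relative-Property-R
- Literature.Barriers.SmoothPoincare4.StrictPropertyTwoRBarrier: outside — Rib and NonRib conclude
the 4-MANIFOLD statement Σ_L ≅ S⁴ (the weak side of GST Prop 9.2), never «L slides to the unlink»;
the relative Property R used on the ribbon stratum (b ≤ 1, Gabai) is the printed theorem, not the
strict Generalised Property R the conditional no-go refutes; Andrews–Curtis enters only through the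
pooled open items (#0378 no 1-handles), never assumed.
- Literature.Barriers.SmoothPoincare4.GluckTwistCP2Barrier: consistent — concordance / ℂℙ²-stable
invariants are blind on homotopy balls, which is exactly why NonRib is DECLARED RESIDUAL and
idea-needed (no obstruction certifies non-ribbonness of a slice system) and why the negative use of
E_L is one-sided; no piece asks such an invariant to see Σ.
- Literature.Barriers.SmoothPoincare4.StableBarrierFour: consistent — no stable-diffeomorphism
invariant is used; the pieces are constructive recognition statements on link strata.
- Literature.Barriers.SmoothPoincare4.HCobordismInvariantBarrierFour: consistent — no h-cobordism
invariant is asked to detect Σ.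
- Literature.Barriers.SmoothPoincare4.HCobordismBarrierFour: not invoked — no piece infers
diffeomorphism from h-cobordism.
- Literature.Barriers.SmoothPoincare4.RelativeContractibleBarrierFour: NOT claimed — the node never
asserts that homotopy-1-handlebody exteriors E_Δ are standard for all ribbon systems

sub-problem: SmoothPoincare4 · status: draft · opened planner-decomp-sp4-writer-1-g2-0 2026-08-30T05:50:17Z · rev 1 · ledger route-SmoothPoincare4-RootDecompQ
GENERATED by the gate from the ledger (D-0016/17). Provers cite these decls: `theorem foo : Summit.SmoothPoincare4.SmoothPoincare4.Theses.RootDecompQ.<Decl> := …` in Summits/SmoothPoincare4/SmoothPoincare4/Theorems/<Name>.lean.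
-/

namespace Summit.SmoothPoincare4.SmoothPoincare4.Theses.RootDecompQ

open scoped BigOperators Topology Manifold Classical MeasureTheory ProbabilityTheory Matrix InnerProductSpace ComplexConjugate ContinuousMap
open Filter Set Function TopologicalSpace MeasureTheory

attribute [summit_statement] _root_.SmoothPoincare4

open Literature.SPC4

/-- item stmt-SmoothPoincare4-26691 · crux · rank 2 · open · by planner
why it might fail: the R-link of a GSC exotic sphere, or a 2-component link à la GST L_(n,k) in a fake ball, strongly slice there and obstructed in B⁴ by a link-concordance invariant NOT blind on homotopy balls (none known: s, τ blind for knots, KM13; for links s-blindness = MMSW Q9.11, open; μ̄ topological).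
sources: arXiv:1103.1601, FreedmanGompfMorrisonWalker2010, arXiv:2102.04391, KronheimerMrowka2013, ManolescuMarengonSarkarWillis2023
[crux] E_L (piece 1, «no LINK certifies a fake 4-ball»; the ATTACKED conjunct; tags WEAKER ·
ATTACKABLE · INSTRUMENTABLE; strictly STRONGER than gen-0 E = ¬#0520, kernel
`hBallSliceIsSlice_of_hBallSystemsSlice`): for every n, every link L ⊂ S³ with n components (tree
`Link (Fin n)`), every smooth 4-manifold M (Hausdorff, second countable, C^∞ on 𝓡 4) homotopy
equivalent to S⁴, every smooth ball e : ℝ⁴ → M and disc maps f i : ℝ² → M: if each f i is a smooth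
proper slice disc for the component L.component i in M ∖ e(B̊⁴) (tree `Knot.IsSliceDiscIn`) and the
closed discs f i(𝔻²) are pairwise disjoint, then L bounds such a system in the round S⁴ minus a ball
(= in B⁴ by Palais): L is strongly slice. S ⟹ E_L kernel (`hBallSystemsSlice_of_spc4`: transport
along M ≅ S⁴); E_L ⟹ S unknown (probe `E_L → S` fails, bc/BC2). [critic decomp-sp4-crit-1 g2,
CLEARED 2026-08-30T02:59:34Z (HOME/STATUS.md line 94): ATTACKED conjunct · WEAKER (dominates F.E
#25344, t1a the moment J is born) · ATTACKABLE · INSTRUMENTABLE (M-SSLICE; s two-sided for links =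
MMSW Q9.11 open) — node score] [difficulty: open-problem] -/
@[route_item "route-SmoothPoincare4-RootDecompQ", crux]
def HBallSystemsSlice : Prop :=
  open scoped ContDiff in ∀ (n : ℕ) (L : Literature.Topology.FourManifolds.Link (Fin n)) (M : Type) [TopologicalSpace M] [T2Space M] [SecondCountableTopology M] [ChartedSpace (EuclideanSpace ℝ (Fin 4)) M] [IsManifold (𝓡 4) ∞ M], ContinuousMap.HomotopyEquiv M (Metric.sphere (0 : EuclideanSpace ℝ (Fin 5)) 1) → ∀ (e : EuclideanSpace ℝ (Fin 4) → M) (f : Fin n → EuclideanSpace ℝ (Fin 2) → M), ((∀ i, (L.component i).IsSliceDiscIn M e (f i)) ∧ Pairwise (fun i j => Disjoint (f i '' Metric.closedBall (0 : EuclideanSpace ℝ (Fin 2)) 1) (f j '' Metric.closedBall (0 : EuclideanSpace ℝ (Fin 2)) 1))) → (∃ (e' : EuclideanSpace ℝ (Fin 4) → (Metric.sphere (0 : EuclideanSpace ℝ (Fin 5)) 1)) (f' : Fin n → EuclideanSpace ℝ (Fin 2) → (Metric.sphere (0 : EuclideanSpace ℝ (Fin 5)) 1)), ((∀ i, (L.component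 i).IsSliceDiscIn (Metric.sphere (0 : EuclideanSpace ℝ (Fin 5)) 1) e' (f' i)) ∧ Pairwise (fun i j => Disjoint (f' i '' Metric.closedBall (0 : EuclideanSpace ℝ (Fin 2)) 1) (f' j '' Metric.closedBall (0 : EuclideanSpace ℝ (Fin 2)) 1))))

/-- item stmt-SmoothPoincare4-27378 · crux · rank 3 · SPLIT (gen 1) into RibbonEmbeddedStandard, NonRibbonEmbeddedStandard + glue EmbeddedGscStandardGlue · direct attempts still welcome (low priority) · by planner
why it might fail: An exotic GSC homotopy sphere that is also a capped Schoenflies ball (the GNS Q5.6 family, if exotic and GSC) defeats it; every decided row (n ≤ 1 Gabai; Q_{p,q} ∪ J MZ22 Thm 1.1; Gompf 1991) is standard outright — no recognition argument has ever USED invertibility, no tool consumes it.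
sources: stmt-SmoothPoincare4-0377 (NoohGscStandard), stmt-SmoothPoincare4-18065 (InvertibleStandard), arXiv:1904.08527 Thm 1.1 p.3 (MeierZupan2022), arXiv:2307.06388 Q5.6 p.13, arXiv:1103.1601 §8 p.18, Question 9.x (GompfScharlemannThompson2010)
R₂ᵦ — R-LINK SPHERES WITH STANDARD PUNCTURES ARE STANDARD: every R-link sphere M = Σ_L all of whose
punctures M ∖ {p} are diffeomorphic to open subsets of the round S⁴ is diffeomorphic to S⁴ (= «GSC ∧
invertible ⟹ standard»). Tags: NEW-as-typed (the common weakening of #0377 NoohGscStandard — kernel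
`Split.embeddedGscStandard_of_gscStandard` over the #0377 body shape — and of #18065
InvertibleStandard on paper (PE ⟹ invertible via Schoenflies-ball complement); no tree item
conditions recognition on BOTH axes) · WEAKER (S ⟹ R₂ᵦ kernel `Split.embeddedGscStandard_of_summit`;
C → (R₂ ⟹ R₂ᵦ) kernel `Split.embeddedGscStandard_of_ssliceRLinkStandard`; R₂ᵦ → S and R₂ᵦ → R₂
probes FAIL; BC7 CLEAN) · DECLARED RESIDUAL (recognition statement; P3 structurally unavailable:
every decided row — n ≤ 1 Gabai Property R, Q_{p,q} ∪ J MeierZupan2022 Thm 1.1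
[corpus:paper:arxiv-1904.08527 p.3], Gompf 1991, Akbulut–Kirby/Cappell–Shaneson families — is
standard OUTRIGHT, so neither hypothesis has ever been consumed) · IDEA-NEEDED (a recognition tool
that USES an embedding Σ° ↪ S⁴ together with a 2-handle presentation: e.g. the LP form «system
exterior E_Δ ≅ ♮ⁿS¹×B³» would follow from GSC ∧ INV iff the co -/
@[route_item "route-SmoothPoincare4-RootDecompQ", crux]
def EmbeddedGscStandard : Prop :=
  open scoped ContDiff in ∀ (n : ℕ) (L : Literature.Topology.FourManifolds.FramedLink (Fin n)) (M : Type) [TopologicalSpace M] [T2Space M] [SecondCountableTopology M] [ChartedSpace (EuclideanSpace ℝ (Fin 4)) M] [IsManifold (𝓡 4) ∞ M], Literature.Topology.FourManifolds.IsRLinkSphere M L → (∀ p : M, ∃ U : TopologicalSpace.Opens (Metric.sphere (0 : EuclideanSpace ℝ (Fin 5)) 1), Nonempty ((⟨({p}ᶜ : Set M), isOpen_compl_singleton⟩ : TopologicalSpace.Opens M) ≃ₘ⟮𝓡 4, 𝓡 4⟯ U)) → Nonempty (M ≃ₘ⟮𝓡 4, 𝓡 4⟯ (Metric.sphere (0 :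 EuclideanSpace ℝ (Fin 5)) 1))

-- parent: EmbeddedGscStandard · child (gen 1)
/--     item stmt-SmoothPoincare4-28762 · crux · rank 301 · open
    parent: EmbeddedGscStandard · by planner
    why it might fail: False only via an exotic R-link sphere with standard punctures whose link bounds a RIBBON system; every decided row (n ≤ 1 Gabai; GST 3.2–3.3; tunnel number n MSZ16; b ≤ 1 bands; 41 census ribbon R-links) is TRUE, but in general it is relative weak GPR for the dual band link C ⊂ #ⁿS¹×S².
    sources: arXiv:1103.1601 Prop 3.2 p.6, §8 p.18 (Questions), Prop 9.2 p.20, §10 p.21 (GompfScharlemannThompson2010), arXiv:1904.08527 Thm 1.1 p.3, p.7 (homotopy-ribbon for every R-link), p.34 (MeierZupan2022), arXiv:1507.06561 (MeierSchirmerZupan2016, tunnel number n), book:magnusnd-combinatorial-group-theory p.347 Cor 5.14.2, LaudenbachPoenaru1972, Gabai1987 Foliations II/III ([Ga2],[Ga3] of GST)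
RIBBON R-LINK SPHERES WITH STANDARD PUNCTURES ARE STANDARD: for every R-link sphere M = Σ_L
(IsRLinkSphere M L) all of whose punctures M ∖ {p} are diffeomorphic to open subsets of the round
S⁴, IF the attaching link L bounds a pairwise-disjoint system of RIBBON discs g_i : 𝔻² → 𝔼⁴ (tree
predicate `Literature.Topology.FourManifolds.Knot.IsRibbonDisc` = smooth neat slice disc on which
the radial function has no interior local maximum, SliceRibbon.lean:119; pairwise-disjoint images of
the closed unit disc), THEN M ≅ S⁴. Lens form (Iff.rfl): `… → PuncturesEmbed M → HasRibbonSystem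
L.toLink → Nonempty (M ≃ₘ S⁴)`. Tags (critic vocabulary): NEW (no tree item / Theses decl quantifies
over ribbon disc SYSTEMS of attaching links; BC4 exact? fails; rg: «ribbon» only for 2-knots in
Gluck routes and knot discs in I's D-RIB) · WEAKER (S ⟹ it kernel
`Ribbon.ribbonEmbeddedStandard_of_summit`; R₂ᵦ ⟹ it kernel
`Ribbon.ribbonEmbeddedStandard_of_embeddedGscStandard`; C → (R₂ ⟹ it) kernel; it ⟹ S / R₂ᵦ / R₂ /
NonRib probes FAIL (bc/BC2_results.txt l.30/40/50/60); BC7 CLEAN) · ATTACKED · ATTACKABLE (ribbon ⟹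
the system exterior E_Δ = B⁴ ∖ N(Δ) is a 0 ∪ m·1 ∪ (m−n)·2-handlebody with π₁ FREE of rank n [co -/
@[route_item "route-SmoothPoincare4-RootDecompQ"]
def RibbonEmbeddedStandard : Prop :=
  open scoped ContDiff in ∀ (n : ℕ) (L : Literature.Topology.FourManifolds.FramedLink (Fin n)) (M : Type) [TopologicalSpace M] [T2Space M] [SecondCountableTopology M] [ChartedSpace (EuclideanSpace ℝ (Fin 4)) M] [IsManifold (𝓡 4) ∞ M], Literature.Topology.FourManifolds.IsRLinkSphere M L → (∀ p : M, ∃ U : TopologicalSpace.Opens (Metric.sphere (0 : EuclideanSpace ℝ (Fin 5)) 1), Nonempty ((⟨({p}ᶜ : Set M), isOpen_compl_singleton⟩ : TopologicalSpace.Opens M) ≃ₘ⟮𝓡 4, 𝓡 4⟯ U)) → (∃ g : Fin n → EuclideanSpace ℝ (Fin 2) → EuclideanSpace ℝ (Fin 4), (∀ i, (L.component i).IsRibbonDisc (g i)) ∧ Pairwise (fun i j => Disjoint (g i '' Metric.closedBall (0 : EuclideanSpace ℝ (Fin 2)) 1) (g j '' Metric.closedBall (0 : EuclideanSpace ℝ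 (Fin 2)) 1))) → Nonempty (M ≃ₘ⟮𝓡 4, 𝓡 4⟯ (Metric.sphere (0 : EuclideanSpace ℝ (Fin 5)) 1))

-- parent: EmbeddedGscStandard · child (gen 1)
/--     item stmt-SmoothPoincare4-28763 · crux · rank 302 · open
    parent: EmbeddedGscStandard · by planner
    why it might fail: The population may be EMPTY (slice ⟹ ribbon for sslice R-links is printed-open, GST §8 Questions on L_{n,k}) or carry an exotic invertible Σ_L; no recognition tool sees ribbon-ness, and the only candidates (L_{n,k}, n ≥ 2, k ≠ 0) have standard spheres (Gompf 1991) anyway.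
    sources: arXiv:1103.1601 §8 p.18 Questions, Prop 2.3 p.5 (GompfScharlemannThompson2010), arXiv:1904.08527 p.7, p.34 (MeierZupan2022: homotopy-ribbon; Stable GPR ⟹ ribbon?), doi:10.1016/0040-9383(91)90036-4 (Gompf 1991, L_{n,k} spheres standard), Literature/Topology/FourManifolds/SliceKnots.lean:112 SliceRibbonConjecture (incomparable, R4: NOT assumed), arXiv:2512.21825 (one-sided ribbon search)
NON-RIBBON R-LINK SPHERES WITH STANDARD PUNCTURES ARE STANDARD: same binders as
RibbonEmbeddedStandard with the ribbon-system hypothesis NEGATED (`¬ ∃ g, (∀ i, IsRibbonDisc (g i))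
∧ pairwise disjoint`): an R-link sphere with standard punctures whose attaching link bounds NO
ribbon disc system is diffeomorphic to S⁴. Tags: NEW · DECLARED RESIDUAL · WEAKER-as-typed (S ⟹ it
kernel `Ribbon.nonRibbonEmbeddedStandard_of_summit`; R₂ᵦ ⟹ it kernel; it ⟹ S / R₂ᵦ / R₂ / Rib probes
FAIL l.34/44/54/64; BC7 CLEAN) · IDEA-NEEDED (a minimal counterexample to SPC4|gsc∧invertible that
survives the ribbon half is an R-link sphere whose link is strongly slice in B⁴ (kernel, gen 3, mod
C: cores transported along the punctured embedding + Palais) but NOT ribbon — i.e. a counterexample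
to «slice ⟹ ribbon» for R-links carrying an exotic sphere; no recognition tool distinguishes this
population and no specimen is known) · POSSIBLY VACUOUS (if every strongly slice R-link is ribbon —
printed-open, GST §8 Questions [corpus:paper:arxiv-1103.1601 p.18]: «For n ≥ 2, k ≠ 0, (n,k) ≠
(2,1), is L_{n,k} a ribbon link?»; every R-link is HOMOTOPY-ribbon in a homotopy ball
[corpus:paper:arxiv-1904.08527 p.7]) — vacuity -/
@[route_item "route-SmoothPoincare4-RootDecompQ"]
def NonRibbonEmbeddedStandard : Prop :=
  open scoped ContDiff in ∀ (n : ℕ) (L : Literature.Topology.FourManifolds.FramedLink (Fin n)) (M : Type) [TopologicalSpace M] [T2Space M] [SecondCountableTopology M] [ChartedSpace (EuclideanSpace ℝ (Fin 4)) M] [IsManifold (𝓡 4) ∞ M], Literature.Topology.FourManifolds.IsRLinkSphere M L → (∀ p : M, ∃ U : TopologicalSpace.Opens (Metric.sphere (0 : EuclideanSpace ℝ (Fin 5)) 1), Nonempty ((⟨({p}ᶜ : Set M), isOpen_compl_singleton⟩ : TopologicalSpace.Opens M) ≃ₘ⟮𝓡 4, 𝓡 4⟯ U)) → ¬ (∃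 g : Fin n → EuclideanSpace ℝ (Fin 2) → EuclideanSpace ℝ (Fin 4), (∀ i, (L.component i).IsRibbonDisc (g i)) ∧ Pairwise (fun i j => Disjoint (g i '' Metric.closedBall (0 : EuclideanSpace ℝ (Fin 2)) 1) (g j '' Metric.closedBall (0 : EuclideanSpace ℝ (Fin 2)) 1))) → Nonempty (M ≃ₘ⟮𝓡 4, 𝓡 4⟯ (Metric.sphere (0 : EuclideanSpace ℝ (Fin 5)) 1))

-- parent: EmbeddedGscStandard · glue (gen 1)
/--     item stmt-SmoothPoincare4-28764 · support · rank 303 · open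
    parent: EmbeddedGscStandard · GLUE: children ⟹ parent · by planner
RibbonEmbeddedStandard → NonRibbonEmbeddedStandard → EmbeddedGscStandard -/
@[route_item "route-SmoothPoincare4-RootDecompQ"]
def EmbeddedGscStandardGlue : Prop :=
  RibbonEmbeddedStandard → NonRibbonEmbeddedStandard → EmbeddedGscStandard

/-- item stmt-SmoothPoincare4-27377 · crux · rank 4 · open · by planner
why it might fail: Strong sliceness embeds X_L = B⁴ ∪ N(Δ̄) in S⁴ but not the 3-handles: Σ_L° ↪ S⁴ needs the n belt spheres to bound disjoint 3-balls in the system exterior E_Δ; an sslice R-link with π₁(E_Δ) not free rel. meridians could carry a non-invertible Σ_L, and no invariant detects that.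
sources: arXiv:1103.1601 Prop 2.3 p.5, §8 p.18 (GompfScharlemannThompson2010), arXiv:2307.06388 Thm 5.5, Q5.4, Q5.6 p.13, HassKirby2025 §4 Q4.2
R₂ₐ — STRONGLY SLICE R-LINKS GIVE SPHERES WITH STANDARD PUNCTURES: for every R-link sphere M = Σ_L
(IsRLinkSphere M L, L an n-component framed R-link) whose attaching link bounds a pairwise-disjoint
SYSTEM of smooth slice discs in the round S⁴ off a ball (≡ strongly slice in B⁴, Palais), every
puncture M ∖ {p} is diffeomorphic to an open subset of the round S⁴ (⟺ M° ↪ S⁴ ⟺ Σ_L is a capped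
Schoenflies ball / invertible in the monoid of homotopy spheres, on paper). Tags (critic
vocabulary): NEW (no tree item quantifies over disc SYSTEMS of links; rg over
Summits/SmoothPoincare4 → only the born parent) · WEAKER (S ⟹ R₂ₐ kernel
`Split.ssliceSpheresEmbed_of_summit`; R₂ ⟹ R₂ₐ outright kernel
`Split.ssliceSpheresEmbed_of_ssliceRLinkStandard`; B2 = Theorems conjecture
PuncturedPoincareSphereEmbedding ≡ #0371 ⟹ R₂ₐ kernel `Split.ssliceSpheresEmbed_of_puncturedEmbeds`;
R₂ₐ → S and R₂ₐ → R₂ probes FAIL, BC7 CLEAN) · UNDECIDED (no row decides it negatively;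
non-invertibility has no detecting invariant, A7/B27-type blindness) · INSTRUMENTABLE one-sided
(test M-INV-SSLICE: for census R-links with a strongly-slice certificate — GST/MZ/M2′ 2-component
families ≤ 14 crossings, Gompf–Scharlemann–Tho -/
@[route_item "route-SmoothPoincare4-RootDecompQ", crux]
def SSliceSpheresEmbed : Prop :=
  open scoped ContDiff in ∀ (n : ℕ) (L : Literature.Topology.FourManifolds.FramedLink (Fin n)) (M : Type) [TopologicalSpace M] [T2Space M] [SecondCountableTopology M] [ChartedSpace (EuclideanSpace ℝ (Fin 4)) M] [IsManifold (𝓡 4) ∞ M], Literature.Topology.FourManifolds.IsRLinkSphere M L → (∃ (e' : EuclideanSpace ℝ (Fin 4) → (Metric.sphere (0 : EuclideanSpace ℝ (Fin 5)) 1)) (f' : Fin n → EuclideanSpace ℝ (Fin 2) → (Metric.sphere (0 : EuclideanSpace ℝ (Fin 5)) 1)), ((∀ i, (L.component i).IsSliceDiscIn (Metric.sphere (0 : EuclideanSpace ℝ (Fin 5)) 1) e' (f' i)) ∧ Pairwise (fun i j => Disjoint (f' i '' Metric.closedBall (0 : EuclideanSpace ℝ (Fin 2)) 1) (f' j '' Metric.closedBall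 (0 : EuclideanSpace ℝ (Fin 2)) 1)))) → ∀ p : M, ∃ U : TopologicalSpace.Opens (Metric.sphere (0 : EuclideanSpace ℝ (Fin 5)) 1), Nonempty ((⟨({p}ᶜ : Set M), isOpen_compl_singleton⟩ : TopologicalSpace.Opens M) ≃ₘ⟮𝓡 4, 𝓡 4⟯ U)

/-- item stmt-SmoothPoincare4-0378 · crux · rank 5 · open · by planner
why it might fail: an exotic S⁴ all of whose handle decompositions need 1-handles; at b₂ = 0 no obstruction to removing 1-handles is known, but none to their necessity either (Kirby 4.18 open since 1978).
sources: Kirby1997, arXiv:1103.1601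
Kirby Problem 4.18 (for all closed simply connected 4-manifolds) specialised to homotopy spheres. No
obstruction known; 1-handle ↔ 3-handle trading needs an embedded-disc input. Sources: Kirby1997
4.18; GompfStipsicz1999 §5.1. -/
@[route_item "route-SmoothPoincare4-RootDecompQ", crux]
def NoOneHandlesExist : Prop :=
  ∀ S : Literature.Topology.FourManifolds.HomotopySphere 4, ∃ f : S.carrier → ℝ, Literature.Topology.FourManifolds.IsMorse (𝓡 4) f ∧ Literature.Topology.FourManifolds.criticalSetOfIndex (𝓡 4) f 1 = ∅

/-- item stmt-SmoothPoincare4-25269 · support · rank 9 · open · by planner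
why it might fail: routine (Milnor Morse theory + handle cancellation bookkeeping); only the formalisation is long.
sources: arXiv:1103.1601, Kirby1989, Milnor1965
[support] the Morse → handlebody bridge (lens W1; support, not a crux): a smooth homotopy 4-sphere
carrying a Morse function without index-1 critical points is an R-link sphere Σ_L for some framed
link L ⊂ S³ (handle decomposition from a generic Morse function, Milnor / GompfStipsicz1999 §4.2; no
1-handles ⇒ the 2-handles attach to B⁴ along a framed link whose trace has boundary #ⁿ S¹ × S², and
the 3/4-handles form a (0;n·1)-handlebody by χ = 2 — GompfScharlemannThompson2010 §9). S-implied
trivially (S⁴ = Σ_∅: tree `isRLinkSphere_sphere_four_empty` + `IsRLinkSphere.of_diffeomorph`,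
kernel-checked in the writer sketch). A textbook fact absent from the tree; provable by anyone idle
once `IsMorse`-to-handle-decomposition infrastructure exists. [difficulty: M] -/
@[route_item "route-SmoothPoincare4-RootDecompQ", crux]
def MorseGscIsRLinkSphere : Prop :=
  ∀ S : Literature.Topology.FourManifolds.HomotopySphere 4, (∃ f : S.carrier → ℝ, Literature.Topology.FourManifolds.IsMorse (𝓡 4) f ∧ Literature.Topology.FourManifolds.criticalSetOfIndex (𝓡 4) f 1 = ∅) → ∃ (n : ℕ) (L : Literature.Topology.FourManifolds.FramedLink (Fin n)), Literature.Topology.FourManifolds.IsRLinkSphere S.carrier L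

/-- item stmt-SmoothPoincare4-26693 · support · rank 9 · open · by planner
why it might fail: it does not (theorem: GST 2010 Prop 2.3 proof; Kirby1989 I §2); formal risk only — the simultaneous version of the landed one-component construction.
sources: arXiv:1103.1601, Kirby1989, Hillman1981
[support] C (support; THEOREM ON PAPER = the printed strength of GST 2010 Prop 2.3 (Hillman), of
which the tree's PROVED `GompfScharlemannThompson2010_prop23` / item #15874 is the componentwise
weakening): if `IsRLinkSphere M L` for a framed n-component link L, then there are a smooth ball e :
ℝ⁴ → M (a shrunken 0-handle) and disc maps f i : ℝ² → M such that each f i is a smooth proper slice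
disc for L.component i in M ∖ e(B̊⁴) and the closed discs are pairwise disjoint — the radial cores
of the 2-handles (the landed proof of #15874 already builds all radial cores at once and separates
them: `pairwise_disjoint_range_of_radial`, `stub_core_isSliceDiscIn_of_isMultiAttachment`). [critic
decomp-sp4-crit-1 g2, CLEARED 2026-08-30T02:59:34Z (line 94): support · THEOREM ON PAPER (GST 2010
Prop 2.3 printed strength; componentwise form tree-PROVED #15874); W3: renamed from the lens decl
CocoreSystem before birth — discs = 2-handle cores ∪ collar annuli] [difficulty: M] -/
@[route_item "route-SmoothPoincare4-RootDecompQ", crux]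
def CoreDiscSystem : Prop :=
  open scoped ContDiff in ∀ (n : ℕ) (L : Literature.Topology.FourManifolds.FramedLink (Fin n)) (M : Type) [TopologicalSpace M] [T2Space M] [SecondCountableTopology M] [ChartedSpace (EuclideanSpace ℝ (Fin 4)) M] [IsManifold (𝓡 4) ∞ M], Literature.Topology.FourManifolds.IsRLinkSphere M L → ∃ (e : EuclideanSpace ℝ (Fin 4) → M) (f : Fin n → EuclideanSpace ℝ (Fin 2) → M), ((∀ i, (L.component i).IsSliceDiscIn M e (f i)) ∧ Pairwise (fun i j => Disjoint (f i '' Metric.closedBall (0 : EuclideanSpace ℝ (Fin 2)) 1) (f j '' Metric.closedBall (0 : EuclideanSpace ℝ (Fin 2)) 1)))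

/-- item stmt-SmoothPoincare4-28758 · assembly · rank 1 · open · by planner
why it might fail: it does not (kernel-proved `Ribbon.closesO6` / `closes6`).
sources: arXiv:1103.1601
[assembly] the flattened deciding chain E_L → G → W → C → R₂ₐ → R₂ᵦ → SmoothPoincare4 (kept for the
schema; the deciding theorem is `closes` in glue_layered.lean; file `aside` if BC6 requires). [deps:
HBallSystemsSlice, NoOneHandlesExist, MorseGscIsRLinkSphere, CoreDiscSystem, SSliceSpheresEmbed,
EmbeddedGscStandard] [difficulty: provable-now] [critic decomp-sp4-crit-1 g2, CLEARED
2026-08-30T05:31:21Z (HOME/STATUS.md line 227; packaging P2a endorsed = OR-sibling with six POOLED J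
items + layer-2 split of EmbeddedGscStandard; P1 resplit in J is tenure/operator-only): cone 6/6
load-bearing at birth (BC1 pass, no warn); deciding theorem = glue.lean `closes` =
routeO/glue_layered.lean VERBATIM (= kernel Ribbon.closesO6; native certificate
routeO/native_check.txt + mine)] Record: lens-4 g4 node RibbonDial (NODE 05:19:23Z line 211, RESULT
line 212); kernel decomp-sp4-lens-4/gen4/RibbonDial.lean sha256
36f8893f1007a31a919a22ffac7a0666f7b6278640035141d7d5f550822b12f1 (rc 0 · 0 sorry · 0 warnings ·
axioms std, RibbonDial.check.txt; certificate against the BORN Theses.RootDecompJ rev 1 sha256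
8a44a357…: embeddedGscStandard_iff_ribbonSplit UNCONDITIONAL (instance of the honest-dial schema emb -/
@[route_item "route-SmoothPoincare4-RootDecompQ"]
def Assembly : Prop :=
  Summit.SmoothPoincare4.SmoothPoincare4.Theses.RootDecompQ.HBallSystemsSlice → Summit.SmoothPoincare4.SmoothPoincare4.Theses.RootDecompQ.NoOneHandlesExist → Summit.SmoothPoincare4.SmoothPoincare4.Theses.RootDecompQ.MorseGscIsRLinkSphere → Summit.SmoothPoincare4.SmoothPoincare4.Theses.RootDecompQ.CoreDiscSystem → Summit.SmoothPoincare4.SmoothPoincare4.Theses.RootDecompQ.SSliceSpheresEmbed → Summit.SmoothPoincare4.SmoothPoincare4.Theses.RootDecompQ.EmbeddedGscStandard → _root_.SmoothPoincare4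

/-! D-0027 §2.1 — DECIDING THEOREM (planner-authored via `route open/edit --closes-file`; by planner-decomp-sp4-writer-1-g2-0 2026-08-30T05:50:17Z):
its hypotheses are this route's items and its conclusion the sub-problem Statement (glue_lint), and it elaborates with this file. -/

-- P2a (RECOMMENDED): deciding theorem of the OR-sibling root route «RootDecompO» over its SIX top-layer items, all POOLED
-- (HBallSystemsSlice = #26691, NoOneHandlesExist = #0378, MorseGscIsRLinkSphere = #25269 support, CoreDiscSystem = #26693 support,
-- SSliceSpheresEmbed = #27377, EmbeddedGscStandard = #27378 — bodies byte-identical to Theses/RootDecompJ.lean rev 1, routeO/pooled_bodies.json).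
-- Text = lens certificate `Ribbon.closesO6` (gen4/RibbonDial.lean, rc 0, axioms {propext, Classical.choice, Quot.sound}); it uses the binders only
-- structurally + the two Literature facts the born RootDecompJ.closes already uses (imports = the born RootDecompJ import list, nothing new).
-- After birth: `route edit --split EmbeddedGscStandard --into RibbonEmbeddedStandard NonRibbonEmbeddedStandard` (EDIT.md step 2).
@[closes "route-SmoothPoincare4-RootDecompQ"] theorem closes (hE : HBallSystemsSlice) (hN : NoOneHandlesExist) (hW : MorseGscIsRLinkSphere)
    (hC : CoreDiscSystem) (hA : SSliceSpheresEmbed) (hB : EmbeddedGscStandard) : _root_.SmoothPoincare4 := by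
  intro M _ _ _ _ _ e
  haveI : CompactSpace M :=
    Literature.Topology.FourManifolds.compactSpace_of_homotopyEquiv_sphere_four_holds M e
  obtain ⟨o⟩ :=
    Literature.Topology.FourManifolds.isOrientable_of_homotopyEquiv_sphere_four_holds M e
  obtain ⟨n, L, hM⟩ := hW ⟨M, o, ⟨e⟩⟩ (hN ⟨M, o, ⟨e⟩⟩)
  obtain ⟨eb, f, hs⟩ := hC n L M hM
  exact hB n L M hM (hA n L M hM (hE n L.toLink M e eb f hs))

end Summit.SmoothPoincare4.SmoothPoincare4.Theses.RootDecompQ
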